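import Mathlib
import HarnessLib
import Summits.SmoothPoincare4.SmoothPoincare4.Theses.SchoenfliesSplit
import Literature.Geometry.Symplectic.GromovMcDuffTwistedSphereProofs
import Literature.Topology.FourManifolds.HomotopySpheresProofs

/-!
# Birth skeleton (BC3) — crux `SchoenfliesSplit.SchsplitCapBridge` (stmt-SmoothPoincare4-11912)

Route `route-SmoothPoincare4-SchoenfliesSplit`, crux `SchsplitCapBridge` (rank 9, hypothesis `hBridge` of the
route's deciding theorem `closes`): **(A) → (B♯) → every homotopy 4-sphere `Σ` is diffeomorphic to `S⁴`**, where
(A) = body of `SchsplitPuncturedEmbeds` (every punctured homotopy 4-sphere `Σ ∖ {p}` smoothly embeds in `ℝ⁴`)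
and (B♯) = body of `SchsplitShellCap` (collared / shell-capping Schoenflies: a two-sided shell embedding
`g : {1-ε < ‖x‖ < 1+ε} → ℝ⁴` agrees on a thinner shell with a smooth embedding `F` of the ball `B(0, 1+δ)`).
TRUE and elementary as mathematics (item docstring; grounder g39-22); the risk is formal (size L–XL).

THE LINE = the item's own informal proof (route file docstring of `SchsplitCapBridge`), cut at its three
natural seams into FOUR named stubs over Mathlib + the tree's `StandardEnd.lean` vocabulary
(`punctured`, `inversion`, `AgreesWithInvertedChartNear`), with the objects of the construction made
DEFINITIONS of this file (no existential bookkeeping between stubs):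

* `scaledChart p r z = e⁻¹ (e p + r • z)` — the rescaled recentred chart `ψ_r` at `p` (`e = extChartAt (𝓡 4) p`);
* `extend p f` — the junk extension of `f : Σ ∖ {p} → ℝ⁴` to `Σ` (`Function.extend Subtype.val f 0`);
* `shellMap p f r = extend p f ∘ ψ_r ∘ ι` — THE SHELL MAP `g` (`ι = inversion`, `ι x = x / ‖x‖²`);
* `insideImage p f r = f (Σ ∖ ψ_r (B̄(0,1)))` (`= P`, the bounded side) and
  `coreImage p f r = f (Σ ∖ ψ_r (B(0,1)))` (`= f(K)`, compact; `Q = (coreImage)ᶜ`);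
* `ChartRadius p r` (`0 < r`, `B̄(e p, 3r) ⊆ e.target`), `TwoSidedShellEmbedding g ginv ε P Q` (VERBATIM the
  antecedents of (B♯)), `BallCap g F Finv ε δ` (VERBATIM the matrix of the conclusion of (B♯)),
  `StandardisedRange p f r Θ Θinv` (`Θ` is a diffeomorphism of `range f` onto `ℝ⁴`, `C^∞` with a `C^∞`
  inverse `Θinv : ℝ⁴ → range f`, which in the rescaled chart is the inversion near `p`:
  `Θ (f x) = r • ι (e x − e p)` on a punctured chart-ball).

The stubs (each a genuine lemma of the line; sizes are Lean-plumbing sizes, the mathematics is folklore):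

* `stub_twoSidedShell` (SHELL DATA from (A); size M–L): for a smooth embedding `f : Σ ∖ {p} → ℝ⁴` there are
  `r` with `ChartRadius p r` and a left inverse `ginv` such that the shell map `g = shellMap p f r` on the shell
  `{1/2 < ‖x‖ < 3/2}` satisfies every antecedent of (B♯) with the two-sidedness data `P = insideImage`,
  `Q = (coreImage)ᶜ` (injectivity of `f`, `ψ_r`, `ι`; `f` is an open map (equidimensional embedding);
  `f(K)` compact since `K = Σ ∖ ψ_r(B(0,1))` is a compact subset of `Σ ∖ {p}`; `g(inner half) ⊆ P`,
  `g(outer half) ⊆ Q`, `P ⊔ Q = ℝ⁴ ∖ g(S³)`).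
* `stub_capFillsInside` (COMPONENT ARGUMENT; size M): if `F` caps `g` (`BallCap`, from (B♯)), then
  `F(B(0,1)) = insideImage` — `V = F(B̊₁)` and `W = P` are connected, open, and closed in `ℝ⁴ ∖ g(S³)`
  (`F(B̄₁) = V ∪ g(S³)`, `f(K) = W ∪ g(S³)`; `W` is connected because `Σ ∖ ψ_r(B̄₁)` is — `Σ` is connected,
  `Literature.Geometry.Symplectic.pathConnectedSpace_of_homotopySphere`, and the annulus `ψ_r(B₃ ∖ B̄₁)` meets
  every clopen piece), and they meet (`F y = g y ∈ P` for `1-δ < ‖y‖ < 1`), so `V = W`. No Jordan–Brouwer.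
* `stub_capGluing` (GLUING `Θ`; size L, the LOAD-BEARING stub): with the cap `F` and `F(B̊₁) = P`, the maps
  `Θ := Finv` on `U₁ = F(B(0,1+δ))` and `Θ := ι ∘ ψ_r⁻¹ ∘ f⁻¹` on `U₂ = f(ψ_r(B(0,1/(1-δ)) ∖ 0))` agree on
  `U₁ ∩ U₂` (injectivity of `F` on `B(0,1+δ)` and `F = g` on the thin shell), `U₁ ∪ U₂ = range f`, and the
  glued `Θ` is a diffeomorphism `range f → ℝ⁴` with inverse `Θinv = F` on `B(0,1+δ)`, `= g` on `{‖w‖ > 1-δ}`;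
  `Θ (f (ψ_r z)) = ι z` for `0 < ‖z‖ < 1`, i.e. `StandardisedRange p f r Θ Θinv` (with `ρ = 1`).
* `stub_chartTransfer` (MANIFOLD TRANSFER; size M): from `StandardisedRange p f r Θ Θinv` and the embedding
  `f`, `Φ := r⁻¹ • (Θ ∘ f)` is a diffeomorphism `Σ ∖ {p} ≃ₘ ℝ⁴` (inverse `f⁻¹ ∘ Θinv ∘ (r • ·)`; `f⁻¹` is `C^∞`
  on the open set `range f`: `Literature.Topology.FourManifolds.contMDiffOn_symm_of_isSmoothEmbedding`,
  `Manifold.IsSmoothEmbedding.isOpenMap_of_finrank_eq`) and `Φ x = r⁻¹ • r • ι (e x − e p) = ι (e x − e p)` on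
  the punctured chart-ball of radius `r ρ`: `AgreesWithInvertedChartNear p Φ`.
* `capBridge_of_pieces : Sig.stub_twoSidedShell → Sig.stub_capFillsInside → Sig.stub_capGluing →
  Sig.stub_chartTransfer → SchsplitPuncturedEmbeds → SchsplitShellCap → ∀ Σ, Nonempty (Σ ≃ₘ S⁴)` — THE REAL
  COMPOSITION, sorry-free: pick `p ∈ Σ` (`HomotopySphere.nonempty`), `f` from (A), the shell data from stub 1,
  FEED (B♯) with it to get the cap `F, Finv, δ`, then stubs 2, 3, 4 and the PROVED tree theorem
  `Literature.Geometry.Symplectic.nonempty_diffeomorph_sphere_of_agreesWithInvertedChartNear` (double of discs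
  `D⁴ ∪_id D⁴ ≅ S⁴`, Hirsch Ch. 8 Thm 2.1; Cerf-free, Palais-free).
* `SchsplitCapBridge_of : SchsplitCapBridge` — THE SKELETON THEOREM: the crux BY NAME from the four declared stubs.

`sorry` occurs ONLY in the four `stub_*` theorems. The `Sig.stub_*` definitions are the stub statements as
closed `Prop`s (hypotheses of the composition and targets of the BC3 probes); `SchsplitCapBridge_of` type-checks
only because each `Sig.stub_X` is definitionally the statement of `stub_X`.

## Disproof used

None exists: `ledger crux ls stmt-SmoothPoincare4-11912` shows no `Disproof.lean`, no `Lines/`, no landed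
`Negative/` lemma (2026-08-17); `ledger negatives --problem SmoothPoincare4` lists no statement about punctured
embeddings / shell caps. The refuter's per-item briefing (2026-08-15) and grounder g39-22 (2026-08-16) record the
crux as TRUE with exactly this proof; the typing risks they name (Opens-subtype embedding of (A), the `P/Q` data fed
to (B♯), the `r`-scaled inverted chart) are isolated here in stubs 1, 1, 4 respectively.

## BC3 probes

For each stub `X ∈ {twoSidedShell, capFillsInside, capGluing, chartTransfer}`: `Sig.stub_X → SchsplitCapBridge` and
`Sig.stub_X → SmoothPoincare4` by `first | exact? | simpa [Sig.stub_X] | (unfold Sig.stub_X; simpa) | aesop`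
(`set_option maxHeartbeats 400000`; file = this file's prefix up to `END OF DEFINITIONS` + the eight `example`s, so
neither the stubs nor `SchsplitCapBridge_of` are in scope) — ALL EIGHT FAIL (2026-08-17, farm `lean check` rc 1,
8 errors `unsolved goals … ⊢ SchsplitCapBridge` / `⊢ SmoothPoincare4`, aesop "failed to prove the goal after
exhaustive search" on each; registrar folder `bc/probes.lean`, raw output in its NOTES.md). No stub is cheaply the
crux or the summit: stub 1 is (A)-side plumbing, stubs 2–3 consume a cap that only (B♯) provides, stub 4 needs a
standardised range that only stubs 1–3 provide.

## References

* M. W. Hirsch, *Differential Topology*, GTM 33 (1976), Ch. 8, Thm. 2.1 (uniqueness of gluing / double of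
  discs). [HirschDT1976]
* J. Milnor, *Lectures on the h-cobordism theorem* (1965), §9. [MilnorHCobordism1965]
* R. S. Palais, *Extending diffeomorphisms*, Proc. AMS 11 (1960). [Palais1960]
* R. C. Kirby, *The topology of 4-manifolds*, LNM 1374 (1989), p. 87. [Kirby1989]
-/

-- `Summit.<Summit>.<Problem>`: single-conjunct summit, the duplicate component is mandated (CONVENTIONS §2).
set_option linter.dupNamespace false
set_option linter.unusedVariables false
set_option autoImplicit false

noncomputable section

namespace Summit.SmoothPoincare4.SmoothPoincare4.Cruxes.SchsplitCapBridge.Birth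

open scoped Manifold ContDiff Topology
open Set Function
open Literature.Topology.FourManifolds (HomotopySphere)
open Literature.Geometry.Symplectic (punctured inversion AgreesWithInvertedChartNear)
open Summit.SmoothPoincare4.SmoothPoincare4.Theses.SchoenfliesSplit

/-- Local notation for the model space `ℝ⁴ = EuclideanSpace ℝ (Fin 4)`. -/
local notation "E4" => EuclideanSpace ℝ (Fin 4)

/-! ## The objects of the construction (definitions, no sorry) -/

section Objects

variable {S : HomotopySphere 4}

/-- The **rescaled recentred chart** `ψ_r z = e⁻¹ (e p + r • z)` at `p` (`e = extChartAt (𝓡 4) p`); for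
`ChartRadius p r` it is a diffeomorphism of `B(0, 3)` onto an open neighbourhood of `p = ψ_r 0`. [folklore] -/
def scaledChart (p : S.carrier) (r : ℝ) (z : E4) : S.carrier :=
  (extChartAt (𝓡 4) p).symm (extChartAt (𝓡 4) p p + r • z)

/-- The **junk extension** to `Σ` of a map `f : Σ ∖ {p} → ℝ⁴` (value `0` at `p`); `extend p f y = f y`
for `y ≠ p` (`Subtype.val` is injective: `Function.Injective.extend_apply`). [folklore] -/
def extend (p : S.carrier) (f : punctured p → E4) : S.carrier → E4 :=
  Function.extend Subtype.val f 0

/-- The **shell map** `g = f ∘ ψ_r ∘ ι` (`ι x = x / ‖x‖²` the inversion of `StandardEnd.lean`): on the shell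
`{1/2 < ‖x‖ < 3/2}` (indeed on `{‖x‖ > 1/3}`) it is the genuine composite `x ↦ f (ψ_r (ι x))`, `ψ_r (ι x) ≠ p`;
elsewhere junk. [folklore] -/
def shellMap (p : S.carrier) (f : punctured p → E4) (r : ℝ) (x : E4) : E4 :=
  extend p f (scaledChart p r (inversion x))

/-- The **inside image** `P = f (Σ ∖ ψ_r (B̄(0,1)))` — the bounded complementary region of the collared
sphere `g(S³) = f (ψ_r (S³))`. [folklore] -/
def insideImage (p : S.carrier) (f : punctured p → E4) (r : ℝ) : Set E4 :=
  f '' {y : punctured p | y.1 ∉ scaledChart p r '' Metric.closedBall (0 : E4) 1}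

/-- The **core image** `f(K)`, `K = Σ ∖ ψ_r (B(0,1))` (compact); `f(K) = insideImage ⊔ g(S³)` and
`Q = (coreImage)ᶜ` is the unbounded region. [folklore] -/
def coreImage (p : S.carrier) (f : punctured p → E4) (r : ℝ) : Set E4 :=
  f '' {y : punctured p | y.1 ∉ scaledChart p r '' Metric.ball (0 : E4) 1}

/-- **Admissible chart radius**: `0 < r` and the closed chart-image ball of radius `3r` about `e p` lies in
the chart target (so `ψ_r` is defined, smooth and injective on `B̄(0, 3)`). [folklore] -/
def ChartRadius (p : S.carrier) (r : ℝ) : Prop :=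
  0 < r ∧ Metric.closedBall (extChartAt (𝓡 4) p p) (3 * r) ⊆ (extChartAt (𝓡 4) p).target

end Objects

/-- **Two-sided shell embedding with sides `P`, `Q`** — VERBATIM the antecedents of (B♯) `SchsplitShellCap`
for `(g, ginv, ε)` and the witnesses `(P, Q)` of its existential two-sidedness hypothesis: `g` is `C^∞` on the
shell `A_ε = {1-ε < ‖x‖ < 1+ε}` with open image and `C^∞` left inverse `ginv` there; `P`, `Q` open, disjoint,
`P ∪ Q = ℝ⁴ ∖ g(S³)`, `P` bounded, `g(inner half-shell) ⊆ P`, `g(outer half-shell) ⊆ Q`. [folklore] -/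
def TwoSidedShellEmbedding (g ginv : E4 → E4) (ε : ℝ) (P Q : Set E4) : Prop :=
  0 < ε ∧ ContDiffOn ℝ ∞ g {x | 1 - ε < ‖x‖ ∧ ‖x‖ < 1 + ε} ∧
    IsOpen (g '' {x | 1 - ε < ‖x‖ ∧ ‖x‖ < 1 + ε}) ∧
    ContDiffOn ℝ ∞ ginv (g '' {x | 1 - ε < ‖x‖ ∧ ‖x‖ < 1 + ε}) ∧
    (∀ x : E4, 1 - ε < ‖x‖ → ‖x‖ < 1 + ε → ginv (g x) = x) ∧
    IsOpen P ∧ IsOpen Q ∧ Disjoint P Q ∧ P ∪ Q = (g '' Metric.sphere 0 1)ᶜ ∧ Bornology.IsBounded P ∧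
    (∀ x : E4, 1 - ε < ‖x‖ → ‖x‖ < 1 → g x ∈ P) ∧ ∀ x : E4, 1 < ‖x‖ → ‖x‖ < 1 + ε → g x ∈ Q

/-- **A ball cap of `g`** — VERBATIM the matrix of the conclusion of (B♯) `SchsplitShellCap`: `0 < δ ≤ ε`, `F`
is `C^∞` on `B(0, 1+δ)`, agrees with `g` on the thin shell `A_δ`, has open image and a `C^∞` left inverse
`Finv` on it. [folklore] -/
def BallCap (g F Finv : E4 → E4) (ε δ : ℝ) : Prop :=
  0 < δ ∧ δ ≤ ε ∧ ContDiffOn ℝ ∞ F (Metric.ball 0 (1 + δ)) ∧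
    (∀ x : E4, 1 - δ < ‖x‖ → ‖x‖ < 1 + δ → F x = g x) ∧ IsOpen (F '' Metric.ball 0 (1 + δ)) ∧
    ContDiffOn ℝ ∞ Finv (F '' Metric.ball 0 (1 + δ)) ∧
    ∀ x ∈ Metric.ball (0 : E4) (1 + δ), Finv (F x) = x

section Objects

variable {S : HomotopySphere 4}

/-- **`Θ` standardises the range of `f` in the rescaled chart**: `Θ` is `C^∞` on `range f` with a global `C^∞`
inverse `Θinv : ℝ⁴ → range f` (so `Θ|` is a diffeomorphism `range f ≅ ℝ⁴`), and on a punctured chart-ball of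
radius `r ρ` about `p`, `Θ (f x) = r • ι (e x − e p)` (`= ι (r⁻¹ • (e x − e p))`: `Θ ∘ f ∘ ψ_r = ι`).
[folklore] -/
def StandardisedRange (p : S.carrier) (f : punctured p → E4) (r : ℝ) (Θ Θinv : E4 → E4) : Prop :=
  ContDiffOn ℝ ∞ Θ (Set.range f) ∧ ContDiff ℝ ∞ Θinv ∧ (∀ u : E4, Θinv u ∈ Set.range f) ∧
    (∀ y ∈ Set.range f, Θinv (Θ y) = y) ∧ (∀ u : E4, Θ (Θinv u) = u) ∧
    ∃ ρ : ℝ, 0 < ρ ∧ ∀ x : punctured p, x.1 ∈ (chartAt E4 p).source →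
      extChartAt (𝓡 4) p x.1 ∈ Metric.ball (extChartAt (𝓡 4) p p) (r * ρ) →
        Θ (f x) = r • inversion (extChartAt (𝓡 4) p x.1 - extChartAt (𝓡 4) p p)

end Objects

/-! ## The stub statements as closed `Prop`s (hypotheses of the composition; BC3 probe targets) -/

/-- Statement of `stub_twoSidedShell`. [folklore] -/
def Sig.stub_twoSidedShell : Prop :=
  ∀ (S : HomotopySphere 4) (p : S.carrier) (f : punctured p → E4),
    Manifold.IsSmoothEmbedding (𝓡 4) (𝓡 4) ∞ f →
    ∃ (r : ℝ) (ginv : E4 → E4), ChartRadius p r ∧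
      TwoSidedShellEmbedding (shellMap p f r) ginv (1 / 2) (insideImage p f r) (coreImage p f r)ᶜ

/-- Statement of `stub_capFillsInside`. [folklore] -/
def Sig.stub_capFillsInside : Prop :=
  ∀ (S : HomotopySphere 4) (p : S.carrier) (f : punctured p → E4),
    Manifold.IsSmoothEmbedding (𝓡 4) (𝓡 4) ∞ f → ∀ (r : ℝ) (ginv : E4 → E4), ChartRadius p r →
    TwoSidedShellEmbedding (shellMap p f r) ginv (1 / 2) (insideImage p f r) (coreImage p f r)ᶜ →
    ∀ (F Finv : E4 → E4) (δ : ℝ), BallCap (shellMap p f r) F Finv (1 / 2) δ →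
    F '' Metric.ball (0 : E4) 1 = insideImage p f r

/-- Statement of `stub_capGluing`. [folklore] -/
def Sig.stub_capGluing : Prop :=
  ∀ (S : HomotopySphere 4) (p : S.carrier) (f : punctured p → E4),
    Manifold.IsSmoothEmbedding (𝓡 4) (𝓡 4) ∞ f → ∀ (r : ℝ) (ginv : E4 → E4), ChartRadius p r →
    TwoSidedShellEmbedding (shellMap p f r) ginv (1 / 2) (insideImage p f r) (coreImage p f r)ᶜ →
    ∀ (F Finv : E4 → E4) (δ : ℝ), BallCap (shellMap p f r) F Finv (1 / 2) δ →
    F '' Metric.ball (0 : E4) 1 = insideImage p f r →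
    ∃ Θ Θinv : E4 → E4, StandardisedRange p f r Θ Θinv

/-- Statement of `stub_chartTransfer`. [folklore] -/
def Sig.stub_chartTransfer : Prop :=
  ∀ (S : HomotopySphere 4) (p : S.carrier) (f : punctured p → E4),
    Manifold.IsSmoothEmbedding (𝓡 4) (𝓡 4) ∞ f → ∀ (r : ℝ), 0 < r → ∀ (Θ Θinv : E4 → E4),
    StandardisedRange p f r Θ Θinv →
    ∃ Φ : (punctured p) ≃ₘ⟮𝓡 4, 𝓡 4⟯ E4, AgreesWithInvertedChartNear p Φ

-- === END OF DEFINITIONS === (the registrar's BC3 probe file is this prefix + probes)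

/-! ## The four registered stubs -/

/-- **Stub 1 `stub_twoSidedShell` — shell data from the punctured embedding (A-side).** For a homotopy 4-sphere
`Σ`, `p ∈ Σ` and a smooth embedding `f : Σ ∖ {p} → ℝ⁴` there are an admissible chart radius `r` and a map
`ginv` such that the shell map `g = f ∘ ψ_r ∘ ι` is a two-sided shell embedding on `{1/2 < ‖x‖ < 3/2}` with
sides `P = f(Σ ∖ ψ_r(B̄₁))`, `Q = ℝ⁴ ∖ f(Σ ∖ ψ_r(B₁))` — i.e. every antecedent of (B♯). Why true: `r` exists as
`e.target ∈ 𝓝 (e p)`; `g` is `C^∞` and injective on the shell (`f`, `ψ_r`, `ι` are), its image is open since an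
equidimensional smooth embedding is an open map (`Manifold.IsSmoothEmbedding.isOpenMap_of_finrank_eq`) with
`C^∞` inverse on its range (`contMDiffOn_symm_of_isSmoothEmbedding`); `K = Σ ∖ ψ_r(B₁)` is a compact subset of
`Σ ∖ {p}` so `f(K)` is compact, `P ⊆ f(K)` is open and bounded, `f(K) ∖ P = f(ψ_r(S³)) = g(S³)`; the half-shell
clauses are injectivity of `f` and `ψ_r`. Known plumbing; size M–L. [folklore] -/
theorem stub_twoSidedShell (S : HomotopySphere 4) (p : S.carrier) (f : punctured p → E4)
    (hf : Manifold.IsSmoothEmbedding (𝓡 4) (𝓡 4) ∞ f) :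
    ∃ (r : ℝ) (ginv : E4 → E4), ChartRadius p r ∧
      TwoSidedShellEmbedding (shellMap p f r) ginv (1 / 2) (insideImage p f r) (coreImage p f r)ᶜ := by
  sorry

/-- **Stub 2 `stub_capFillsInside` — the cap fills exactly the inside (component argument).** If `F` caps the
shell map `g` (`BallCap`, the output of (B♯)), then `F(B(0,1)) = P = f(Σ ∖ ψ_r(B̄₁))`. Why true: `V = F(B̊₁)`
and `W = P` are nonempty, open, connected (`W` because `Σ ∖ ψ_r(B̄₁)` is connected: `Σ` is path connected —
`Literature.Geometry.Symplectic.pathConnectedSpace_of_homotopySphere` — and the connected annulus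
`ψ_r(B₃ ∖ B̄₁)` meets every clopen piece) and closed in `X = ℝ⁴ ∖ g(S³)` (`closure V ⊆ F(B̄₁) = V ∪ F(S³)`,
`closure W ⊆ f(K) = W ∪ g(S³)`, and `F(S³) = g(S³)`), hence connected components of `X`; they meet at
`F y = g y ∈ P`, `1 - δ < ‖y‖ < 1`, so `V = W`. Elementary topology; size M. [folklore] -/
theorem stub_capFillsInside (S : HomotopySphere 4) (p : S.carrier) (f : punctured p → E4)
    (hf : Manifold.IsSmoothEmbedding (𝓡 4) (𝓡 4) ∞ f) (r : ℝ) (ginv : E4 → E4) (hr : ChartRadius p r)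
    (hshell : TwoSidedShellEmbedding (shellMap p f r) ginv (1 / 2) (insideImage p f r) (coreImage p f r)ᶜ)
    (F Finv : E4 → E4) (δ : ℝ) (hcap : BallCap (shellMap p f r) F Finv (1 / 2) δ) :
    F '' Metric.ball (0 : E4) 1 = insideImage p f r := by
  sorry

/-- **Stub 3 `stub_capGluing` — gluing the cap inverse to the inverted chart (THE LOAD-BEARING STUB).** Given
the cap `F` of `g = f ∘ ψ_r ∘ ι` with `F(B̊₁) = P`, there are `Θ`, `Θinv` with `StandardisedRange p f r Θ Θinv`.
Why true: on `U₁ = F(B(0,1+δ))` put `Θ = Finv`, on `U₂ = f(ψ_r(B(0, 1/(1-δ)) ∖ 0))` put `Θ = ι ∘ ψ_r⁻¹ ∘ f⁻¹`;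
`U₁ ∪ U₂ ⊇ range f = P ∪ f(ψ_r(B̄₁ ∖ 0))`; on `U₁ ∩ U₂`, `u = f(ψ_r z) = F x` forces `x = ι z` (if
`1/(1+δ) < ‖z‖` then `F (ι z) = g (ι z) = u` and `F` is injective on `B(0,1+δ)`; if `‖z‖ ≤ 1/(1+δ)` then
`u ∉ f(K) ⊇ P ∪ g(S³) ∪ …` contradicts `u = F x`), so the pieces agree; `Θinv = F` on `B(0,1+δ)` and `= g` on
`{‖w‖ > 1-δ}` is a global `C^∞` inverse into `range f`; and `Θ (f (ψ_r z)) = ι z` for `0 < ‖z‖ < 1` reads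
`Θ (f x) = r • ι (e x − e p)` on the punctured chart-ball of radius `r` (`ρ = 1`). Size L. [folklore] -/
theorem stub_capGluing (S : HomotopySphere 4) (p : S.carrier) (f : punctured p → E4)
    (hf : Manifold.IsSmoothEmbedding (𝓡 4) (𝓡 4) ∞ f) (r : ℝ) (ginv : E4 → E4) (hr : ChartRadius p r)
    (hshell : TwoSidedShellEmbedding (shellMap p f r) ginv (1 / 2) (insideImage p f r) (coreImage p f r)ᶜ)
    (F Finv : E4 → E4) (δ : ℝ) (hcap : BallCap (shellMap p f r) F Finv (1 / 2) δ)
    (hfill : F '' Metric.ball (0 : E4) 1 = insideImage p f r) :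
    ∃ Θ Θinv : E4 → E4, StandardisedRange p f r Θ Θinv := by
  sorry

/-- **Stub 4 `stub_chartTransfer` — from a standardised range to a standard end (manifold transfer).** If
`f : Σ ∖ {p} → ℝ⁴` is a smooth embedding and `StandardisedRange p f r Θ Θinv` (`0 < r`), then
`Φ := r⁻¹ • (Θ ∘ f)` is a diffeomorphism `Σ ∖ {p} ≃ₘ ℝ⁴` agreeing with the inverted recentred chart near `p`.
Why true: `f` is a diffeomorphism onto the open set `range f` (`Manifold.IsSmoothEmbedding.isOpenMap_of_finrank_eq`,
`Literature.Topology.FourManifolds.contMDiffOn_symm_of_isSmoothEmbedding`), `Θ` one of `range f` onto `ℝ⁴`,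
scaling one of `ℝ⁴`; inverse `w ↦ f⁻¹ (Θinv (r • w))`; and `Φ x = r⁻¹ • r • ι (e x − e p)` on the punctured
chart-ball of radius `r ρ` is `AgreesWithInvertedChartNear p Φ` (`agreesWithInvertedChartNear_of`). Size M.
[folklore] -/
theorem stub_chartTransfer (S : HomotopySphere 4) (p : S.carrier) (f : punctured p → E4)
    (hf : Manifold.IsSmoothEmbedding (𝓡 4) (𝓡 4) ∞ f) (r : ℝ) (hr : 0 < r) (Θ Θinv : E4 → E4)
    (hΘ : StandardisedRange p f r Θ Θinv) :
    ∃ Φ : (punctured p) ≃ₘ⟮𝓡 4, 𝓡 4⟯ E4, AgreesWithInvertedChartNear p Φ := by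
  sorry

/-! ## The composition (sorry-free) -/

/-- **Composition with explicit hypotheses**: the four stub statements, (A) `SchsplitPuncturedEmbeds` and (B♯)
`SchsplitShellCap` give `Σ ≅ S⁴` for every homotopy 4-sphere `Σ`. Proof: pick `p ∈ Σ` (`HomotopySphere.nonempty`),
`f` from (A) (the `Opens` literal of (A) is `punctured p` definitionally), shell data `(r, ginv)` from stub 1, FEED
(B♯) with `g = shellMap p f r`, `ginv`, `ε = 1/2` and the sides `P = insideImage`, `Q = (coreImage)ᶜ` to obtain
the cap `(F, Finv, δ)`, then stub 2 (`F(B̊₁) = P`), stub 3 (`Θ`), stub 4 (`Φ`) and conclude by the PROVED tree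
theorem `Literature.Geometry.Symplectic.nonempty_diffeomorph_sphere_of_agreesWithInvertedChartNear`. [folklore] -/
theorem capBridge_of_pieces (h₁ : Sig.stub_twoSidedShell) (h₂ : Sig.stub_capFillsInside)
    (h₃ : Sig.stub_capGluing) (h₄ : Sig.stub_chartTransfer)
    (hA : SchsplitPuncturedEmbeds) (hB : SchsplitShellCap) (S : HomotopySphere 4) :
    Nonempty (S.carrier ≃ₘ⟮𝓡 4, 𝓡 4⟯ Metric.sphere (0 : EuclideanSpace ℝ (Fin 5)) 1) := by
  obtain ⟨p⟩ := S.nonempty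
  obtain ⟨f, hf⟩ := hA S p
  obtain ⟨r, ginv, hr, hshell⟩ := h₁ S p f hf
  obtain ⟨hε, hg, hgo, hginv, hleft, hP, hQ, hdisj, hunion, hbdd, hin, hout⟩ := hshell
  obtain ⟨F, Finv, δ, hcap⟩ := hB (shellMap p f r) ginv (1 / 2) hε hg hgo hginv hleft
    ⟨insideImage p f r, (coreImage p f r)ᶜ, hP, hQ, hdisj, hunion, hbdd, hin, hout⟩
  have hshell' : TwoSidedShellEmbedding (shellMap p f r) ginv (1 / 2) (insideImage p f r) (coreImage p f r)ᶜ :=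
    ⟨hε, hg, hgo, hginv, hleft, hP, hQ, hdisj, hunion, hbdd, hin, hout⟩
  have hfill : F '' Metric.ball (0 : E4) 1 = insideImage p f r := h₂ S p f hf r ginv hr hshell' F Finv δ hcap
  obtain ⟨Θ, Θinv, hΘ⟩ := h₃ S p f hf r ginv hr hshell' F Finv δ hcap hfill
  obtain ⟨Φ, hΦ⟩ := h₄ S p f hf r hr.1 Θ Θinv hΘ
  exact Literature.Geometry.Symplectic.nonempty_diffeomorph_sphere_of_agreesWithInvertedChartNear p Φ hΦ

/-- **THE SKELETON THEOREM.** The crux `Summit.SmoothPoincare4.SmoothPoincare4.Theses.SchoenfliesSplit.SchsplitCapBridge`,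
concluded BY NAME from the four DECLARED stubs `stub_twoSidedShell`, `stub_capFillsInside`, `stub_capGluing`,
`stub_chartTransfer` (the only `sorry`s of the file) through the sorry-free composition `capBridge_of_pieces`.
[folklore] -/
theorem SchsplitCapBridge_of :
    Summit.SmoothPoincare4.SmoothPoincare4.Theses.SchoenfliesSplit.SchsplitCapBridge :=
  fun hA hB S => capBridge_of_pieces stub_twoSidedShell stub_capFillsInside stub_capGluing
    stub_chartTransfer hA hB S

end Summit.SmoothPoincare4.SmoothPoincare4.Cruxes.SchsplitCapBridge.Birth

end
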